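/-
Copyright (c) 2026 the pub-hodgecm-mathlib formalisation cell (harness21).  Prover seat hodgecm-mathlib-LH4-p07 (g8): Track A «(D-RAM) FOUR-FRAME» squad of crux H413,
STAGE-1b PRE-SCOPING (heir LEAD F0P3a-plan (g20) T19-24 «allowed as scoping»; socket-(B) lineage of the (ρ2b′-X) road), organ (E1) «GLUE LEVEL, PLANE LETTERS» — the
LEVEL ∕ ENDOMORPHISM twin of ★ T2c `UnitaryLatticeTreeBlockGlueFixed` §3 (LH4-p05 (g4)) over ★ (c3-i) `UnitaryLatticeTreeTubeCone` (F0P2-p01 (g16)), 2026-09-04.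
-/
import Literature.NumberTheory.Automorphic.UnitaryLatticeTreeBlockGlueFixed     -- ★ T2c (LH4-p05 (g4)): the plane bridge `ι_W` (`mem_map_planeMatrix_iff`, …), `v_apply_one_le_one_of_single_one_mem`; brings ★ T2a, ★ (TC)∕(TC′), ★ `…TubeCoordinate`
import Literature.NumberTheory.Automorphic.UnitaryLatticeTreeTubeCollarRankToken -- ★ p849247 (F0P2-p01): `endoGL_sub_one_sq_row`; brings ★ `…TubeCollarTokens` (`endoGL_sub_one_{col,row,apply_one_one}`, `endoGL_sub_one_sq_col`) and ★ (c3-i) `…TubeCone.forall_mulVec_mem_scaleLattice_iff_of_tubeCoordinate`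
import HarnessLib

/-!
# The lattice graph of a hermitian space — LEVELS OF A BLOCK ENDOMORPHISM ON A GLUED SELF-DUAL LATTICE, IN PLANE LETTERS: `X·M ⊆ c·M` iff `|X₁₁| ≤ |c|`,
# `c⁻¹X_W·B₂ ⊆ B₂` and `c⁻¹(X_W w₀ − X₁₁ w₀) ∈ B₂` on the plane glue data `(B₂, w₀)` — the profile predicates of the type-(2) census (Kottwitz 1986 §1; Bruhat–Tits 1972 §10)

Topic `NumberTheory/Automorphic`; namespace `Literature.NumberTheory.Automorphic.UnitaryLatticeTree`.  THEOREMS ONLY (no definition, no instance, no notation, no named fact,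
no `sorry`); kernel lane `--supports stmt-HodgeConjecture-24833`; DATUM-FREE (`K` with `Valued K ℤᵐ⁰`, `σ` a valuation-preserving ring endomorphism, `|ϖ| = exp(−1)`; no
`|2| = 1`, no `σϖ = ±ϖ`, no residue field).  Cell `pub/hodgecm-mathlib`, crux H413 = `stmt-HodgeConjecture-24833`; squad F0∕P3c∕LH4 «(D-RAM) FOUR-FRAME», STAGE-1b scoping:
the TYPE-(2) POPULATION (row (2)) of the three residual profile pieces of ★ `Theorems/F0P3cDyRamPieceRowsWildLinear` (F0P3a-p01 (g35): the `T₊`-labelled shell, the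
congruence pieces `𝟙_{K_{a,b}}`, `𝟙{K ∧ X² ∈ ϖ^b M₃}`).  Their G-side census functions count `Γ`-FIXED type-0 vertices `M` satisfying the PROFILE PREDICATES of ★
`Theorems/F0P3cDyRamFourFrameCensusDefs` — `LatticeInLevel ϖ ℓ (Γ − 1) M : (Γ − 1)·M ⊆ ϖ^ℓ·M` and `LatticeInLevel ϖ m ((Γ − 1)²) M` — which on the type-(2) population must
be evaluated on the GLUE DATA of the ★ (ρ2b′-X) chain (★ T2a∕T2c, ★ `Theorems/F0P3cDyRamBlockGluePlane` ∕ `…BlockGlueCount` (LH4-p07 (g6)), ★ (C1)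
`Theorems/F0P3cDyRamBlockCensusOrderForm`), whose currency is the PLANE data `(B₂, w₀)`: `ι_W(B₂) = M ∩ W`, `pr_W x₀ = ι_W w₀`, `B₂^♯ = B₂ + 𝒪w₀`.
★ T2c §3 ∕ ★ `…BlockGluePlane.mapGL_endoGL_eq_iff_plane` read FIXEDNESS `Γ·M = M` in these letters (`γ₂B₂ = B₂ ∧ γ₂w₀ − u·w₀ ∈ B₂`); ★ (c3-i)
`forall_mulVec_mem_scaleLattice_iff_of_tubeCoordinate` decides `S·M ⊆ c·M` for ANY block operator `S` in the `(M, x₀)` letters of the «S3-ram» tube road.  THIS FILE joins the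
two: ★ (c3-i) in ★ T2c's `M ∩ W`-letters and then in PLANE letters, for a general block-at-1 `S` (`S = Γ − 1`, `(Γ − 1)²`: not a group element, `S₁₁` not a unit) and any
`c ≠ 0` (`c = ϖ^ℓ`), with the two instances of record spelled out.  Count-neutral; pays no stub; states no census law.
HONEST LABEL: HC_CM is proved only modulo the 7 printed citations (2 remaining named inputs: hLiu418 = stmt-HodgeConjecture-24832, h413 = stmt-HodgeConjecture-24833) until rung 0
closes; elementary lattice algebra over a valuation ring, nothing printed is asserted.

THE MATHEMATICS (BLOCK CURRENCY of ★ `UnitaryLatticeTreeTubeCoordinate` ∕ ★ T2a ∕ ★ T2c: `V = K³ = W ⊕ Ke₁`, `W = {x | x₁ = 0}`, block form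
`H = !![H₂ 0 0, 0, H₂ 0 1; 0, h, 0; H₂ 1 0, 0, H₂ 1 1]`, `pr_W x = x − x₁e₁`, `ι_W y = (y₀, 0, y₁)`; `S` BLOCK AT `1`: column `1` = `S₁₁·e₁`, row `1` zero off the diagonal;
its COMPRESSION `S_W = !![S₀₀, S₀₂; S₂₀, S₂₂]` gives `S·ι_W y = ι_W(S_W y)`).
* §0 Block-at-1 matrices: closed under `*`, `−`, `a • ·`, contain `1`, `(S·T)₁₁ = S₁₁T₁₁`; the compression is multiplicative ∕ additive ∕ homogeneous; `(ι(γ₂, u))_W = γ₂`,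
  `(Γ − 1)_W = γ₂ − 1`, `((Γ − 1)²)_W = (γ₂ − 1)²` (`((Γ − 1)²)₁₁ = (u − 1)²` and the block shape of the square are ★ `endoGL_sub_one_sq_col` ∕ ★ `endoGL_sub_one_sq_row`).
* §1 ★ (c3-i) IN `M ∩ W`-LETTERS (`M` with tube coordinate `b`, generator `x₀`; NO self-duality):
  `S·M ⊆ c·M ⟺ |S₁₁| ≤ |c| ∧ (∀ y ∈ M ∩ W, c⁻¹·S y ∈ M ∩ W) ∧ c⁻¹·(S·pr_W x₀ − S₁₁·pr_W x₀) ∈ M ∩ W`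
  (`(S − S₁₁)x₀ = (S − S₁₁)pr_W x₀ ∈ W`: ★ `sub_smul_mulVec_eq_of_block`, ★ `sub_smul_mulVec_apply_one_of_block`); AXIS form (`b = 0`, `e₁ ∈ M`, `|x₁| ≤ 1` on `M`):
  `S·M ⊆ c·M ⟺ |S₁₁| ≤ |c| ∧ ∀ y ∈ M ∩ W, c⁻¹·S y ∈ M ∩ W`; for a SELF-DUAL `M ∋ e₁` the axis hypotheses are automatic (★ T2c `v_apply_one_le_one_of_single_one_mem`).
* §2 PLANE LETTERS: `S·ι_W(B₂) ⊆ ι_W(B₂) ⟺ S_W·B₂ ⊆ B₂` and `c′·(S·ι_W w₀ − a·ι_W w₀) ∈ ι_W(B₂) ⟺ c′·(S_W w₀ − a·w₀) ∈ B₂` for a general block `S` (★ T2c §3 did `S = Γ`);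
  whence, on plane glue data `(B₂, w₀, x₀)`:  **`S·M ⊆ c·M ⟺ |S₁₁| ≤ |c| ∧ (∀ y ∈ B₂, c⁻¹·S_W y ∈ B₂) ∧ c⁻¹·(S_W w₀ − S₁₁ w₀) ∈ B₂`**
  (`forall_mulVec_mem_scaleLattice_iff_plane`), and the two instances of record:
  `(Γ − 1)·M ⊆ c·M ⟺ |u − 1| ≤ |c| ∧ (∀ y ∈ B₂, c⁻¹(γ₂ − 1)y ∈ B₂) ∧ c⁻¹(γ₂w₀ − u·w₀) ∈ B₂` — the SAME witness `γ₂w₀ − u·w₀` as ★ T2c's fixed criterion, one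
  level deeper — and `(Γ − 1)²·M ⊆ c·M ⟺ |(u − 1)²| ≤ |c| ∧ (∀ y ∈ B₂, c⁻¹(γ₂ − 1)²y ∈ B₂) ∧ c⁻¹((γ₂ − 1)²w₀ − (u − 1)²·w₀) ∈ B₂`.
  In ★ (C1)'s line model (`B₂ = x·𝒪_j`, `γ₂ ↦ lam`, `u ↦ jE u`) these read `(lam − 1)∕c ∈ 𝒪_j`, `((lam − u)∕c)·B₂^♯ ⊆ B₂` resp. `(lam − 1)²∕c ∈ 𝒪_j`,
  `(((lam − 1)² − (u − 1)²)∕c)·B₂^♯ ⊆ B₂` — the depth clauses of `levelSetDep (j, b; (lam − u)∕c)` and of a SECOND multiplier `(lam − u)(lam + u − 2)∕c`; the consumer's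
  (C1-P) organ, not typed here.

## References
* [Kottwitz1986BaseChangeUnits] R. E. Kottwitz, *Base change for unit elements of Hecke algebras*, Compositio Math. 60 (1986), §1 pp. 240–241 (orbital integrals of
  units as fixed-lattice counts; lattices as modules over `𝒪[γ]`).
* [BruhatTits1972] F. Bruhat, J. Tits, *Groupes réductifs sur un corps local I*, Publ. Math. IHÉS 41 (1972), §10 (lattice models of the rank-one building; tube layers; congruence filtrations of vertex stabilisers).
* [Jacobowitz1962] R. Jacobowitz, *Hermitian forms over local fields*, Amer. J. Math. 84 (1962), §4 (dual lattices, gluing of modular components).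
* [Rogawski1990] J. D. Rogawski, *Automorphic Representations of Unitary Groups in Three Variables*, Ann. of Math. Stud. 123 (1990), §4.8 Case (a) p. 53, §4.9–§4.10 pp. 55–60.
-/

set_option autoImplicit false
noncomputable section
open scoped Valued WithZero Matrix MatrixGroups

namespace Literature.NumberTheory.Automorphic.UnitaryLatticeTree

open Literature.NumberTheory.Automorphic Literature.NumberTheory.Automorphic.HermitianLattice Literature.NumberTheory.Rogawski1990

variable {K : Type*} [Field K] [Valued K ℤᵐ⁰]

/-! ## §0 Block-at-1 matrices: a unital subalgebra; compression to the plane -/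

section Block

omit [Valued K ℤᵐ⁰]

/-- Column `1` of a product of block-at-1 matrices vanishes off the diagonal. [cite: BruhatTits1972, §10] -/
theorem block_mul_col_one {S T : Matrix (Fin 3) (Fin 3) K} (hS : ∀ l, l ≠ 1 → S l 1 = 0) (hT : ∀ l, l ≠ 1 → T l 1 = 0) (l : Fin 3) (hl : l ≠ 1) :
    (S * T) l 1 = 0 := by
  rw [Matrix.mul_apply, Fin.sum_univ_three, hT 0 (by decide), hT 2 (by decide), hS l hl]; ring

/-- Row `1` of a product of block-at-1 matrices vanishes off the diagonal. [cite: BruhatTits1972, §10] -/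
theorem block_mul_row_one {S T : Matrix (Fin 3) (Fin 3) K} (hS : ∀ l, l ≠ 1 → S 1 l = 0) (hT : ∀ l, l ≠ 1 → T 1 l = 0) (l : Fin 3) (hl : l ≠ 1) :
    (S * T) 1 l = 0 := by
  rw [Matrix.mul_apply, Fin.sum_univ_three, hS 0 (by decide), hS 2 (by decide), hT l hl]; ring

/-- The middle entry is multiplicative on block-at-1 matrices: `(S·T)₁₁ = S₁₁·T₁₁`. [cite: BruhatTits1972, §10] -/
theorem block_mul_one_one {S T : Matrix (Fin 3) (Fin 3) K} (hS : ∀ l, l ≠ 1 → S 1 l = 0) : (S * T) 1 1 = S 1 1 * T 1 1 := by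
  rw [Matrix.mul_apply, Fin.sum_univ_three, hS 0 (by decide), hS 2 (by decide)]; ring

/-- Column `1` of the identity is `e₁`. [cite: BruhatTits1972, §10] -/
theorem one_col_one (l : Fin 3) (hl : l ≠ 1) : (1 : Matrix (Fin 3) (Fin 3) K) l 1 = 0 := Matrix.one_apply_ne hl

/-- Row `1` of the identity vanishes off the diagonal. [cite: BruhatTits1972, §10] -/
theorem one_row_one (l : Fin 3) (hl : l ≠ 1) : (1 : Matrix (Fin 3) (Fin 3) K) 1 l = 0 := Matrix.one_apply_ne (Ne.symm hl)

/-- Column `1` of a difference of block-at-1 matrices. [cite: BruhatTits1972, §10] -/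
theorem block_sub_col_one {S T : Matrix (Fin 3) (Fin 3) K} (hS : ∀ l, l ≠ 1 → S l 1 = 0) (hT : ∀ l, l ≠ 1 → T l 1 = 0) (l : Fin 3) (hl : l ≠ 1) :
    (S - T) l 1 = 0 := by
  rw [Matrix.sub_apply, hS l hl, hT l hl, sub_zero]

/-- Row `1` of a difference of block-at-1 matrices. [cite: BruhatTits1972, §10] -/
theorem block_sub_row_one {S T : Matrix (Fin 3) (Fin 3) K} (hS : ∀ l, l ≠ 1 → S 1 l = 0) (hT : ∀ l, l ≠ 1 → T 1 l = 0) (l : Fin 3) (hl : l ≠ 1) :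
    (S - T) 1 l = 0 := by
  rw [Matrix.sub_apply, hS l hl, hT l hl, sub_zero]

/-- Column `1` of a scalar multiple of a block-at-1 matrix. [cite: BruhatTits1972, §10] -/
theorem block_smul_col_one {S : Matrix (Fin 3) (Fin 3) K} (hS : ∀ l, l ≠ 1 → S l 1 = 0) (a : K) (l : Fin 3) (hl : l ≠ 1) : (a • S) l 1 = 0 := by
  rw [Matrix.smul_apply, hS l hl, smul_zero]

/-- Row `1` of a scalar multiple of a block-at-1 matrix. [cite: BruhatTits1972, §10] -/
theorem block_smul_row_one {S : Matrix (Fin 3) (Fin 3) K} (hS : ∀ l, l ≠ 1 → S 1 l = 0) (a : K) (l : Fin 3) (hl : l ≠ 1) : (a • S) 1 l = 0 := by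
  rw [Matrix.smul_apply, hS l hl, smul_zero]

/-- A matrix whose row `1` vanishes off the diagonal acts on `W` through its compression: `S·(y₀, 0, y₁) = ((S_W y)₀, 0, (S_W y)₁)`, `S_W = !![S₀₀, S₀₂; S₂₀, S₂₂]`
(★ T2c `endoGL_mulVec_plane` is the case `S = ι(γ₂, u)`, `S_W = γ₂`). [cite: BruhatTits1972, §10] [cite: Rogawski1990, §4.8 Case (a) p. 53] -/
theorem mulVec_plane_of_row_one {S : Matrix (Fin 3) (Fin 3) K} (hrow : ∀ l, l ≠ 1 → S 1 l = 0) (y : Fin 2 → K) :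
    S *ᵥ (![y 0, 0, y 1] : Fin 3 → K) =
      ![((!![S 0 0, S 0 2; S 2 0, S 2 2] : Matrix (Fin 2) (Fin 2) K) *ᵥ y) 0, 0, ((!![S 0 0, S 0 2; S 2 0, S 2 2] : Matrix (Fin 2) (Fin 2) K) *ᵥ y) 1] := by
  have h0 := hrow 0 (by decide)
  have h2 := hrow 2 (by decide)
  ext i; fin_cases i <;> simp [Matrix.mulVec, dotProduct, Fin.sum_univ_three, Fin.sum_univ_two, h0, h2]

/-- The same on a vector of `W` given by its coordinates (`w₁ = 0`). [cite: BruhatTits1972, §10] -/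
theorem mulVec_of_row_one_of_apply_one_eq_zero {S : Matrix (Fin 3) (Fin 3) K} (hrow : ∀ l, l ≠ 1 → S 1 l = 0) {w : Fin 3 → K} (hw : w 1 = 0) :
    S *ᵥ w = ![((!![S 0 0, S 0 2; S 2 0, S 2 2] : Matrix (Fin 2) (Fin 2) K) *ᵥ ![w 0, w 2]) 0, 0,
      ((!![S 0 0, S 0 2; S 2 0, S 2 2] : Matrix (Fin 2) (Fin 2) K) *ᵥ ![w 0, w 2]) 1] := by
  conv_lhs => rw [eq_plane_of_apply_one_eq_zero hw]
  exact mulVec_plane_of_row_one hrow ![w 0, w 2]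

/-- The compression is multiplicative (the right factor's row `1` vanishing off the diagonal suffices). [cite: BruhatTits1972, §10] -/
theorem compress_mul {S T : Matrix (Fin 3) (Fin 3) K} (hT : ∀ l, l ≠ 1 → T 1 l = 0) :
    (!![(S * T) 0 0, (S * T) 0 2; (S * T) 2 0, (S * T) 2 2] : Matrix (Fin 2) (Fin 2) K) =
      !![S 0 0, S 0 2; S 2 0, S 2 2] * !![T 0 0, T 0 2; T 2 0, T 2 2] := by
  have h0 := hT 0 (by decide)
  have h2 := hT 2 (by decide)
  ext i j; fin_cases i <;> fin_cases j <;> simp [Matrix.mul_apply, Fin.sum_univ_three, Fin.sum_univ_two, h0, h2]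

/-- The compression is subtractive. [cite: BruhatTits1972, §10] -/
theorem compress_sub (S T : Matrix (Fin 3) (Fin 3) K) :
    (!![(S - T) 0 0, (S - T) 0 2; (S - T) 2 0, (S - T) 2 2] : Matrix (Fin 2) (Fin 2) K) = !![S 0 0, S 0 2; S 2 0, S 2 2] - !![T 0 0, T 0 2; T 2 0, T 2 2] := by
  ext i j; fin_cases i <;> fin_cases j <;> simp

/-- The compression commutes with scalars. [cite: BruhatTits1972, §10] -/
theorem compress_smul (a : K) (S : Matrix (Fin 3) (Fin 3) K) :
    (!![(a • S) 0 0, (a • S) 0 2; (a • S) 2 0, (a • S) 2 2] : Matrix (Fin 2) (Fin 2) K) = a • !![S 0 0, S 0 2; S 2 0, S 2 2] := by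
  ext i j; fin_cases i <;> fin_cases j <;> simp

/-- The compression of the identity is the identity. [cite: BruhatTits1972, §10] -/
theorem compress_one : (!![(1 : Matrix (Fin 3) (Fin 3) K) 0 0, (1 : Matrix (Fin 3) (Fin 3) K) 0 2; (1 : Matrix (Fin 3) (Fin 3) K) 2 0, (1 : Matrix (Fin 3) (Fin 3) K) 2 2] :
      Matrix (Fin 2) (Fin 2) K) = 1 := by
  ext i j; fin_cases i <;> fin_cases j <;> simp

/-- The compression of the block element `ι(γ₂, u)` is `γ₂`. [cite: Rogawski1990, §4.8 Case (a) p. 53] -/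
theorem compress_endoGL (γ₂ : GL (Fin 2) K) (u : GL (Fin 1) K) :
    (!![((endoGL (γ₂, u) : GL (Fin 3) K) : Matrix (Fin 3) (Fin 3) K) 0 0, ((endoGL (γ₂, u) : GL (Fin 3) K) : Matrix (Fin 3) (Fin 3) K) 0 2;
        ((endoGL (γ₂, u) : GL (Fin 3) K) : Matrix (Fin 3) (Fin 3) K) 2 0, ((endoGL (γ₂, u) : GL (Fin 3) K) : Matrix (Fin 3) (Fin 3) K) 2 2] : Matrix (Fin 2) (Fin 2) K) =
      (γ₂ : Matrix (Fin 2) (Fin 2) K) := by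
  rw [coe_endoGL_eq_endoShape]
  ext i j; fin_cases i <;> fin_cases j <;> rfl

/-- The compression of `Γ − 1` is `γ₂ − 1`. [cite: Rogawski1990, §4.8 Case (a) p. 53] -/
theorem compress_endoGL_sub_one (γ₂ : GL (Fin 2) K) (u : GL (Fin 1) K) :
    (!![(((endoGL (γ₂, u) : GL (Fin 3) K) : Matrix (Fin 3) (Fin 3) K) - 1) 0 0, (((endoGL (γ₂, u) : GL (Fin 3) K) : Matrix (Fin 3) (Fin 3) K) - 1) 0 2;
        (((endoGL (γ₂, u) : GL (Fin 3) K) : Matrix (Fin 3) (Fin 3) K) - 1) 2 0, (((endoGL (γ₂, u) : GL (Fin 3) K) : Matrix (Fin 3) (Fin 3) K) - 1) 2 2] : Matrix (Fin 2) (Fin 2) K) =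
      (γ₂ : Matrix (Fin 2) (Fin 2) K) - 1 := by
  rw [compress_sub, compress_endoGL, compress_one]

/-- The compression of `(Γ − 1)²` is `(γ₂ − 1)²`. [cite: Rogawski1990, §4.8 Case (a) p. 53] -/
theorem compress_endoGL_sub_one_sq (γ₂ : GL (Fin 2) K) (u : GL (Fin 1) K) :
    (!![((((endoGL (γ₂, u) : GL (Fin 3) K) : Matrix (Fin 3) (Fin 3) K) - 1) * (((endoGL (γ₂, u) : GL (Fin 3) K) : Matrix (Fin 3) (Fin 3) K) - 1)) 0 0,
          ((((endoGL (γ₂, u) : GL (Fin 3) K) : Matrix (Fin 3) (Fin 3) K) - 1) * (((endoGL (γ₂, u) : GL (Fin 3) K) : Matrix (Fin 3) (Fin 3) K) - 1)) 0 2;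
        ((((endoGL (γ₂, u) : GL (Fin 3) K) : Matrix (Fin 3) (Fin 3) K) - 1) * (((endoGL (γ₂, u) : GL (Fin 3) K) : Matrix (Fin 3) (Fin 3) K) - 1)) 2 0,
          ((((endoGL (γ₂, u) : GL (Fin 3) K) : Matrix (Fin 3) (Fin 3) K) - 1) * (((endoGL (γ₂, u) : GL (Fin 3) K) : Matrix (Fin 3) (Fin 3) K) - 1)) 2 2] : Matrix (Fin 2) (Fin 2) K) =
      ((γ₂ : Matrix (Fin 2) (Fin 2) K) - 1) * ((γ₂ : Matrix (Fin 2) (Fin 2) K) - 1) := by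
  rw [compress_mul (endoGL_sub_one_row γ₂ u), compress_endoGL_sub_one]

/-- `(Γ − 1)·w − (u − 1)·w = Γ·w − u·w`: the depth witness of `Γ − 1` is ★ T2c's fixed-criterion witness. [cite: Kottwitz1986BaseChangeUnits, §1 pp. 240–241] -/
theorem sub_one_mulVec_sub_sub_one_smul (A : Matrix (Fin 2) (Fin 2) K) (a : K) (w : Fin 2 → K) :
    (A - 1) *ᵥ w - (a - 1) • w = A *ᵥ w - a • w := by
  rw [Matrix.sub_mulVec, Matrix.one_mulVec, sub_smul, one_smul]; abel

end Block

/-! ## §1 ★ (c3-i) in `M ∩ W`-letters; the axis form -/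

/-- `X·M ⊆ c·M ⟺ (c⁻¹X)·M ⊆ M` (`c ≠ 0`; ★ `mem_scaleLattice_iff`). [cite: BruhatTits1972, §10] -/
theorem forall_mulVec_mem_scaleLattice_iff_forall_smul_mulVec_mem {c : K} (hc : c ≠ 0) (X : Matrix (Fin 3) (Fin 3) K) (M : Submodule 𝒪[K] (Fin 3 → K)) :
    (∀ x ∈ M, X *ᵥ x ∈ scaleLattice c M) ↔ ∀ x ∈ M, (c⁻¹ • X) *ᵥ x ∈ M := by
  refine forall₂_congr fun x _ => ?_
  rw [mem_scaleLattice_iff hc, Matrix.smul_mulVec]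

/-- **★ (c3-i) IN `M ∩ W`-LETTERS.**  `S` block at `1`, `c ≠ 0`, `M` with tube coordinate `b` (`a·e₁ ∈ M ⟺ |a| ≤ |ϖ|^b`, `|x₁|·|ϖ|^b ≤ 1` on `M`) and a generator `x₀`
(`|x₀,₁|·|ϖ|^b = 1`); NO self-duality.  Then
`S·M ⊆ c·M ⟺ |S₁₁| ≤ |c| ∧ (∀ y ∈ M ∩ W, c⁻¹·S y ∈ M ∩ W) ∧ c⁻¹·(S·pr_W x₀ − S₁₁·pr_W x₀) ∈ M ∩ W`, `pr_W x₀ = x₀ − x₀,₁e₁`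
— ★ `forall_mulVec_mem_scaleLattice_iff_of_tubeCoordinate` with `S·(M ∩ W) ⊆ W` (row shape) and `(S − S₁₁)x₀ = (S − S₁₁)pr_W x₀ ∈ W` (★ `sub_smul_mulVec_eq_of_block`,
★ `sub_smul_mulVec_apply_one_of_block`).  `S = Γ − 1`, `c = ϖ^ℓ`: the depth-`ℓ` profile `LatticeInLevel`; `S = (Γ − 1)²`: the square-level profile.
[cite: Kottwitz1986BaseChangeUnits, §1 pp. 240–241] [cite: BruhatTits1972, §10] -/
theorem forall_mulVec_mem_scaleLattice_iff_inf_ker {ϖ : K} (hϖ : Valued.v ϖ = WithZero.exp (-1 : ℤ)) {S : Matrix (Fin 3) (Fin 3) K}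
    (hcol : ∀ l, l ≠ 1 → S l 1 = 0) (hrow : ∀ l, l ≠ 1 → S 1 l = 0) {c : K} (hc : c ≠ 0)
    {M : Submodule 𝒪[K] (Fin 3 → K)} {b : ℕ} (hb : ∀ a : K, (Pi.single 1 a : Fin 3 → K) ∈ M ↔ Valued.v a ≤ Valued.v ϖ ^ b)
    (hpr : ∀ x ∈ M, Valued.v (x 1) * Valued.v ϖ ^ b ≤ 1) {x₀ : Fin 3 → K} (hx₀ : x₀ ∈ M) (hx₀1 : Valued.v (x₀ 1) * Valued.v ϖ ^ b = 1) :
    (∀ x ∈ M, S *ᵥ x ∈ scaleLattice c M) ↔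
      Valued.v (S 1 1) ≤ Valued.v c ∧
      (∀ y ∈ M ⊓ LinearMap.ker ((LinearMap.proj (1 : Fin 3) : (Fin 3 → K) →ₗ[K] K).restrictScalars 𝒪[K]),
          c⁻¹ • (S *ᵥ y) ∈ M ⊓ LinearMap.ker ((LinearMap.proj (1 : Fin 3) : (Fin 3 → K) →ₗ[K] K).restrictScalars 𝒪[K])) ∧
        c⁻¹ • (S *ᵥ (x₀ - Pi.single 1 (x₀ 1)) - S 1 1 • (x₀ - Pi.single 1 (x₀ 1))) ∈
          M ⊓ LinearMap.ker ((LinearMap.proj (1 : Fin 3) : (Fin 3 → K) →ₗ[K] K).restrictScalars 𝒪[K]) := by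
  rw [forall_mulVec_mem_scaleLattice_iff_of_tubeCoordinate hϖ hcol hc hb hpr hx₀ hx₀1]
  refine and_congr Iff.rfl (and_congr ?_ ?_)
  · constructor
    · rintro h y ⟨hyM, hyW⟩
      have hy1 := (mem_kerProj_one_iff y).1 hyW
      refine ⟨(mem_scaleLattice_iff hc M _).1 (h y hyM hy1), (mem_kerProj_one_iff _).2 ?_⟩
      rw [Pi.smul_apply, mulVec_apply_eq_zero_of_row_eq S 1 hrow hy1, smul_zero]
    · intro h w hwM hw1
      exact (mem_scaleLattice_iff hc M _).2 (h w ⟨hwM, (mem_kerProj_one_iff w).2 hw1⟩).1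
  · rw [sub_smul_mulVec_eq_of_block hcol x₀, mem_scaleLattice_iff hc]
    have h1 : ((c⁻¹ • (S *ᵥ (x₀ - Pi.single 1 (x₀ 1)) - S 1 1 • (x₀ - Pi.single 1 (x₀ 1))) : Fin 3 → K) 1) = 0 := by
      rw [← sub_smul_mulVec_eq_of_block hcol x₀, Pi.smul_apply, sub_smul_mulVec_apply_one_of_block hrow x₀, smul_zero]
    exact ⟨fun h => ⟨h, (mem_kerProj_one_iff _).2 h1⟩, fun h => h.1⟩

/-- **THE AXIS FORM** (`b = 0`): for `M` with `a·e₁ ∈ M ⟺ |a| ≤ 1` and `|x₁| ≤ 1` on `M` (so `e₁ ∈ M` is a generator), `S` block at `1` and `c ≠ 0`: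
`S·M ⊆ c·M ⟺ |S₁₁| ≤ |c| ∧ ∀ y ∈ M ∩ W, c⁻¹·S y ∈ M ∩ W` (the generator clause of §1 is vacuous: `pr_W e₁ = 0`). [cite: Kottwitz1986BaseChangeUnits, §1 pp. 240–241] [cite: BruhatTits1972, §10] -/
theorem forall_mulVec_mem_scaleLattice_iff_inf_ker_of_axis {ϖ : K} (hϖ : Valued.v ϖ = WithZero.exp (-1 : ℤ)) {S : Matrix (Fin 3) (Fin 3) K}
    (hcol : ∀ l, l ≠ 1 → S l 1 = 0) (hrow : ∀ l, l ≠ 1 → S 1 l = 0) {c : K} (hc : c ≠ 0)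
    {M : Submodule 𝒪[K] (Fin 3 → K)} (hb : ∀ a : K, (Pi.single 1 a : Fin 3 → K) ∈ M ↔ Valued.v a ≤ 1) (hpr : ∀ x ∈ M, Valued.v (x 1) ≤ 1) :
    (∀ x ∈ M, S *ᵥ x ∈ scaleLattice c M) ↔
      Valued.v (S 1 1) ≤ Valued.v c ∧
      ∀ y ∈ M ⊓ LinearMap.ker ((LinearMap.proj (1 : Fin 3) : (Fin 3 → K) →ₗ[K] K).restrictScalars 𝒪[K]),
        c⁻¹ • (S *ᵥ y) ∈ M ⊓ LinearMap.ker ((LinearMap.proj (1 : Fin 3) : (Fin 3 → K) →ₗ[K] K).restrictScalars 𝒪[K]) := by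
  have hb0 : ∀ a : K, (Pi.single 1 a : Fin 3 → K) ∈ M ↔ Valued.v a ≤ Valued.v ϖ ^ 0 := fun a => by rw [pow_zero]; exact hb a
  have hpr0 : ∀ x ∈ M, Valued.v (x 1) * Valued.v ϖ ^ 0 ≤ 1 := fun x hx => by rw [pow_zero, mul_one]; exact hpr x hx
  have he : (Pi.single 1 1 : Fin 3 → K) ∈ M := (hb 1).2 (by rw [map_one])
  have he1 : Valued.v ((Pi.single 1 1 : Fin 3 → K) 1) * Valued.v ϖ ^ 0 = 1 := by simp
  rw [forall_mulVec_mem_scaleLattice_iff_inf_ker hϖ hcol hrow hc hb0 hpr0 he he1]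
  have hz : (Pi.single 1 1 : Fin 3 → K) - Pi.single 1 ((Pi.single 1 1 : Fin 3 → K) 1) = 0 := by simp
  rw [hz, Matrix.mulVec_zero, smul_zero, sub_zero, smul_zero]
  exact ⟨fun h => ⟨h.1, h.2.1⟩, fun h => ⟨h.1, h.2, Submodule.zero_mem _⟩⟩

/-- **THE AXIS FORM FOR A SELF-DUAL LATTICE THROUGH `e₁`** (block form, `|h| = 1`): `S·M ⊆ c·M ⟺ |S₁₁| ≤ |c| ∧ ∀ y ∈ M ∩ W, c⁻¹·S y ∈ M ∩ W` — the axis hypotheses of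
the previous statement hold by ★ T2c `v_apply_one_le_one_of_single_one_mem` (`|x₁| ≤ 1` on `M`).  The LEVEL twin of ★ T2c `mapGL_endoGL_eq_iff_of_single_one_mem`.
[cite: Kottwitz1986BaseChangeUnits, §1 pp. 240–241] [cite: Jacobowitz1962, §4] [cite: BruhatTits1972, §10] -/
theorem forall_mulVec_mem_scaleLattice_iff_of_single_one_mem (σ : K →+* K) (hvσ : ∀ a, Valued.v (σ a) = Valued.v a) {ϖ : K} (hϖ : Valued.v ϖ = WithZero.exp (-1 : ℤ))
    {H₂ : Matrix (Fin 2) (Fin 2) K} {h : K} (hh : Valued.v h = 1)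
    {M : Submodule 𝒪[K] (Fin 3 → K)} (hM : IsSelfDualLattice σ ϖ (!![H₂ 0 0, 0, H₂ 0 1; 0, h, 0; H₂ 1 0, 0, H₂ 1 1] : Matrix (Fin 3) (Fin 3) K) M)
    (he : (Pi.single 1 1 : Fin 3 → K) ∈ M) {S : Matrix (Fin 3) (Fin 3) K} (hcol : ∀ l, l ≠ 1 → S l 1 = 0) (hrow : ∀ l, l ≠ 1 → S 1 l = 0) {c : K} (hc : c ≠ 0) :
    (∀ x ∈ M, S *ᵥ x ∈ scaleLattice c M) ↔
      Valued.v (S 1 1) ≤ Valued.v c ∧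
      ∀ y ∈ M ⊓ LinearMap.ker ((LinearMap.proj (1 : Fin 3) : (Fin 3 → K) →ₗ[K] K).restrictScalars 𝒪[K]),
        c⁻¹ • (S *ᵥ y) ∈ M ⊓ LinearMap.ker ((LinearMap.proj (1 : Fin 3) : (Fin 3 → K) →ₗ[K] K).restrictScalars 𝒪[K]) := by
  have hpr : ∀ x ∈ M, Valued.v (x 1) ≤ 1 := fun x hx => v_apply_one_le_one_of_single_one_mem σ hvσ hh hM he hx
  have hb : ∀ a : K, (Pi.single 1 a : Fin 3 → K) ∈ M ↔ Valued.v a ≤ 1 := fun a => by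
    constructor
    · intro ha; simpa using hpr _ ha
    · intro ha
      have e : (Pi.single 1 a : Fin 3 → K) = a • (Pi.single 1 1 : Fin 3 → K) := by rw [← Pi.single_smul, smul_eq_mul, mul_one]
      rw [e]; exact M.smul_mem (⟨a, (mem_integer_iff' _).2 ha⟩ : 𝒪[K]) he
  exact forall_mulVec_mem_scaleLattice_iff_inf_ker_of_axis hϖ hcol hrow hc hb hpr

/-! ## §2 Plane letters -/

section Plane

omit [Valued K ℤᵐ⁰] in
/-- The outer coordinates of `ι_W y = (y₀, 0, y₁)` recover `y`. [cite: BruhatTits1972, §10] -/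
theorem plane_coords (y : Fin 2 → K) : (![(![y 0, 0, y 1] : Fin 3 → K) 0, (![y 0, 0, y 1] : Fin 3 → K) 2] : Fin 2 → K) = y := by
  ext i; fin_cases i <;> simp

/-- **STABILITY OF THE `W`-PART, READ ON THE PLANE**: for `S` with row `1` vanishing off the diagonal, `S·ι_W(B₂) ⊆ ι_W(B₂) ⟺ S_W·B₂ ⊆ B₂` (★ T2c
`forall_endoGL_mulVec_mem_map_planeMatrix_iff` is the case `S = Γ`). [cite: Kottwitz1986BaseChangeUnits, §1 pp. 240–241] [cite: BruhatTits1972, §10] -/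
theorem forall_mulVec_mem_map_planeMatrix_iff {S : Matrix (Fin 3) (Fin 3) K} (hrow : ∀ l, l ≠ 1 → S 1 l = 0) (B₂ : Submodule 𝒪[K] (Fin 2 → K)) :
    (∀ w ∈ B₂.map ((Matrix.toLin' (!![1, 0; 0, 0; 0, 1] : Matrix (Fin 3) (Fin 2) K)).restrictScalars 𝒪[K]),
        S *ᵥ w ∈ B₂.map ((Matrix.toLin' (!![1, 0; 0, 0; 0, 1] : Matrix (Fin 3) (Fin 2) K)).restrictScalars 𝒪[K])) ↔
      ∀ y ∈ B₂, (!![S 0 0, S 0 2; S 2 0, S 2 2] : Matrix (Fin 2) (Fin 2) K) *ᵥ y ∈ B₂ := by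
  constructor
  · intro hst y hy
    have hw : (![y 0, 0, y 1] : Fin 3 → K) ∈ B₂.map ((Matrix.toLin' (!![1, 0; 0, 0; 0, 1] : Matrix (Fin 3) (Fin 2) K)).restrictScalars 𝒪[K]) := by
      rw [mem_map_planeMatrix_iff, plane_coords]; exact ⟨by simp, hy⟩
    have h := hst _ hw
    rw [mulVec_plane_of_row_one hrow, mem_map_planeMatrix_iff, plane_coords] at h
    exact h.2
  · intro hst w hw
    obtain ⟨hw1, hwB⟩ := (mem_map_planeMatrix_iff B₂ w).1 hw
    rw [mulVec_of_row_one_of_apply_one_eq_zero hrow hw1, mem_map_planeMatrix_iff, plane_coords]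
    exact ⟨by simp, hst _ hwB⟩

/-- The scaled form: `a·S w ∈ ι_W(B₂)` for all `w ∈ ι_W(B₂)` iff `a·S_W y ∈ B₂` for all `y ∈ B₂`. [cite: Kottwitz1986BaseChangeUnits, §1 pp. 240–241] [cite: BruhatTits1972, §10] -/
theorem forall_smul_mulVec_mem_map_planeMatrix_iff {S : Matrix (Fin 3) (Fin 3) K} (hrow : ∀ l, l ≠ 1 → S 1 l = 0) (a : K) (B₂ : Submodule 𝒪[K] (Fin 2 → K)) :
    (∀ w ∈ B₂.map ((Matrix.toLin' (!![1, 0; 0, 0; 0, 1] : Matrix (Fin 3) (Fin 2) K)).restrictScalars 𝒪[K]),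
        a • (S *ᵥ w) ∈ B₂.map ((Matrix.toLin' (!![1, 0; 0, 0; 0, 1] : Matrix (Fin 3) (Fin 2) K)).restrictScalars 𝒪[K])) ↔
      ∀ y ∈ B₂, a • ((!![S 0 0, S 0 2; S 2 0, S 2 2] : Matrix (Fin 2) (Fin 2) K) *ᵥ y) ∈ B₂ := by
  have e : ∀ w : Fin 3 → K, a • (S *ᵥ w) = (a • S) *ᵥ w := fun w => (Matrix.smul_mulVec a S w).symm
  have e2 : ∀ y : Fin 2 → K, a • ((!![S 0 0, S 0 2; S 2 0, S 2 2] : Matrix (Fin 2) (Fin 2) K) *ᵥ y) =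
      (!![(a • S) 0 0, (a • S) 0 2; (a • S) 2 0, (a • S) 2 2] : Matrix (Fin 2) (Fin 2) K) *ᵥ y := fun y => by
    rw [compress_smul, Matrix.smul_mulVec]
  simp only [e, e2]
  exact forall_mulVec_mem_map_planeMatrix_iff (block_smul_row_one hrow a) B₂

/-- **THE GENERATOR WITNESS, READ ON THE PLANE**: `a·(S·ι_W w₀ − a′·ι_W w₀) ∈ ι_W(B₂) ⟺ a·(S_W w₀ − a′·w₀) ∈ B₂` (row `1` of `S` vanishing off the diagonal; `a′ = S₁₁`
in the criteria; ★ T2c `endoGL_mulVec_plane_sub_smul_mem_map_planeMatrix_iff` is `S = Γ`, `a = 1`, `a′ = u`). [cite: Kottwitz1986BaseChangeUnits, §1 pp. 240–241] [cite: BruhatTits1972, §10] -/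
theorem smul_mulVec_plane_sub_smul_mem_map_planeMatrix_iff {S : Matrix (Fin 3) (Fin 3) K} (hrow : ∀ l, l ≠ 1 → S 1 l = 0) (a a' : K) (B₂ : Submodule 𝒪[K] (Fin 2 → K))
    (w₀ : Fin 2 → K) :
    a • (S *ᵥ (![w₀ 0, 0, w₀ 1] : Fin 3 → K) - a' • (![w₀ 0, 0, w₀ 1] : Fin 3 → K)) ∈
        B₂.map ((Matrix.toLin' (!![1, 0; 0, 0; 0, 1] : Matrix (Fin 3) (Fin 2) K)).restrictScalars 𝒪[K]) ↔
      a • ((!![S 0 0, S 0 2; S 2 0, S 2 2] : Matrix (Fin 2) (Fin 2) K) *ᵥ w₀ - a' • w₀) ∈ B₂ := by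
  rw [mulVec_plane_of_row_one hrow, mem_map_planeMatrix_iff]
  have e : (![(a • (![((!![S 0 0, S 0 2; S 2 0, S 2 2] : Matrix (Fin 2) (Fin 2) K) *ᵥ w₀) 0, 0, ((!![S 0 0, S 0 2; S 2 0, S 2 2] : Matrix (Fin 2) (Fin 2) K) *ᵥ w₀) 1] -
          a' • ![w₀ 0, 0, w₀ 1]) : Fin 3 → K) 0,
      (a • (![((!![S 0 0, S 0 2; S 2 0, S 2 2] : Matrix (Fin 2) (Fin 2) K) *ᵥ w₀) 0, 0, ((!![S 0 0, S 0 2; S 2 0, S 2 2] : Matrix (Fin 2) (Fin 2) K) *ᵥ w₀) 1] -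
          a' • ![w₀ 0, 0, w₀ 1]) : Fin 3 → K) 2] : Fin 2 → K) =
        a • ((!![S 0 0, S 0 2; S 2 0, S 2 2] : Matrix (Fin 2) (Fin 2) K) *ᵥ w₀ - a' • w₀) := by
    ext i; fin_cases i <;> simp [Pi.smul_apply, smul_eq_mul, Matrix.vecHead, Matrix.vecTail]
  rw [e]
  exact ⟨fun hx => hx.2, fun hx => ⟨by simp, hx⟩⟩

/-- **LEVELS OF A BLOCK ENDOMORPHISM IN PLANE LETTERS.**  `S` block at `1`, `c ≠ 0`; `M` with tube coordinate `b`, generator `x₀ ∈ M` and PLANE GLUE DATA `(B₂, w₀)`: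
`ι_W(B₂) = M ∩ W`, `pr_W x₀ = ι_W w₀` (★ T2a∕T2c ∕ ★ `…BlockGluePlane` §2; no self-duality needed here).  Then
**`S·M ⊆ c·M ⟺ |S₁₁| ≤ |c| ∧ (∀ y ∈ B₂, c⁻¹·S_W y ∈ B₂) ∧ c⁻¹·(S_W w₀ − S₁₁·w₀) ∈ B₂`.**
[cite: Kottwitz1986BaseChangeUnits, §1 pp. 240–241] [cite: BruhatTits1972, §10] [cite: Jacobowitz1962, §4] -/
theorem forall_mulVec_mem_scaleLattice_iff_plane {ϖ : K} (hϖ : Valued.v ϖ = WithZero.exp (-1 : ℤ)) {S : Matrix (Fin 3) (Fin 3) K}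
    (hcol : ∀ l, l ≠ 1 → S l 1 = 0) (hrow : ∀ l, l ≠ 1 → S 1 l = 0) {c : K} (hc : c ≠ 0)
    {M : Submodule 𝒪[K] (Fin 3 → K)} {b : ℕ} (hb : ∀ a : K, (Pi.single 1 a : Fin 3 → K) ∈ M ↔ Valued.v a ≤ Valued.v ϖ ^ b)
    (hpr : ∀ x ∈ M, Valued.v (x 1) * Valued.v ϖ ^ b ≤ 1)
    {B₂ : Submodule 𝒪[K] (Fin 2 → K)} {w₀ : Fin 2 → K} {x₀ : Fin 3 → K}
    (hB : B₂.map ((Matrix.toLin' (!![1, 0; 0, 0; 0, 1] : Matrix (Fin 3) (Fin 2) K)).restrictScalars 𝒪[K]) =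
      M ⊓ LinearMap.ker ((LinearMap.proj (1 : Fin 3) : (Fin 3 → K) →ₗ[K] K).restrictScalars 𝒪[K]))
    (hx₀ : x₀ ∈ M) (hx₀1 : Valued.v (x₀ 1) * Valued.v ϖ ^ b = 1) (hprx : x₀ - Pi.single 1 (x₀ 1) = ![w₀ 0, 0, w₀ 1]) :
    (∀ x ∈ M, S *ᵥ x ∈ scaleLattice c M) ↔
      Valued.v (S 1 1) ≤ Valued.v c ∧
      (∀ y ∈ B₂, c⁻¹ • ((!![S 0 0, S 0 2; S 2 0, S 2 2] : Matrix (Fin 2) (Fin 2) K) *ᵥ y) ∈ B₂) ∧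
        c⁻¹ • ((!![S 0 0, S 0 2; S 2 0, S 2 2] : Matrix (Fin 2) (Fin 2) K) *ᵥ w₀ - S 1 1 • w₀) ∈ B₂ := by
  rw [forall_mulVec_mem_scaleLattice_iff_inf_ker hϖ hcol hrow hc hb hpr hx₀ hx₀1, ← hB, forall_smul_mulVec_mem_map_planeMatrix_iff hrow, hprx,
    smul_mulVec_plane_sub_smul_mem_map_planeMatrix_iff hrow]

/-- **HEADLINE 1 — THE DEPTH-`c` PROFILE OF `Γ − 1` IN PLANE LETTERS** (the LEVEL twin of ★ `Theorems/F0P3cDyRamBlockGluePlane.mapGL_endoGL_eq_iff_plane`).  For `M` with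
tube coordinate `b`, generator `x₀`, plane glue data `(B₂, w₀)` as above, a block element `Γ = ι(γ₂, u)` and `c ≠ 0`:
`(Γ − 1)·M ⊆ c·M ⟺ |u − 1| ≤ |c| ∧ (∀ y ∈ B₂, c⁻¹·(γ₂ − 1)y ∈ B₂) ∧ c⁻¹·(γ₂w₀ − u·w₀) ∈ B₂`
— the SAME witness `γ₂w₀ − u·w₀` as ★ T2c's fixed criterion, one level deeper (`c = ϖ^ℓ`: the predicate `LatticeInLevel ϖ ℓ (Γ − 1) M` of the congruence pieces).
In ★ (C1)'s line model (`B₂ = x·𝒪_j`, `γ₂ ↦ lam`, `B₂^♯ = B₂ + 𝒪w₀`): `(lam − 1)∕c ∈ 𝒪_j` and `((lam − u)∕c)·B₂^♯ ⊆ B₂`.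
[cite: Kottwitz1986BaseChangeUnits, §1 pp. 240–241] [cite: BruhatTits1972, §10] [cite: Jacobowitz1962, §4] [cite: Rogawski1990, §4.9–§4.10 pp. 55–60] -/
theorem forall_endoGL_sub_one_mulVec_mem_scaleLattice_iff_plane {ϖ : K} (hϖ : Valued.v ϖ = WithZero.exp (-1 : ℤ)) {c : K} (hc : c ≠ 0)
    {M : Submodule 𝒪[K] (Fin 3 → K)} {b : ℕ} (hb : ∀ a : K, (Pi.single 1 a : Fin 3 → K) ∈ M ↔ Valued.v a ≤ Valued.v ϖ ^ b)
    (hpr : ∀ x ∈ M, Valued.v (x 1) * Valued.v ϖ ^ b ≤ 1)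
    {B₂ : Submodule 𝒪[K] (Fin 2 → K)} {w₀ : Fin 2 → K} {x₀ : Fin 3 → K}
    (hB : B₂.map ((Matrix.toLin' (!![1, 0; 0, 0; 0, 1] : Matrix (Fin 3) (Fin 2) K)).restrictScalars 𝒪[K]) =
      M ⊓ LinearMap.ker ((LinearMap.proj (1 : Fin 3) : (Fin 3 → K) →ₗ[K] K).restrictScalars 𝒪[K]))
    (hx₀ : x₀ ∈ M) (hx₀1 : Valued.v (x₀ 1) * Valued.v ϖ ^ b = 1) (hprx : x₀ - Pi.single 1 (x₀ 1) = ![w₀ 0, 0, w₀ 1])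
    (γ₂ : GL (Fin 2) K) (u : GL (Fin 1) K) :
    (∀ x ∈ M, (((endoGL (γ₂, u) : GL (Fin 3) K) : Matrix (Fin 3) (Fin 3) K) - 1) *ᵥ x ∈ scaleLattice c M) ↔
      Valued.v ((u : Matrix (Fin 1) (Fin 1) K) 0 0 - 1) ≤ Valued.v c ∧
      (∀ y ∈ B₂, c⁻¹ • (((γ₂ : Matrix (Fin 2) (Fin 2) K) - 1) *ᵥ y) ∈ B₂) ∧
        c⁻¹ • ((γ₂ : Matrix (Fin 2) (Fin 2) K) *ᵥ w₀ - (u : Matrix (Fin 1) (Fin 1) K) 0 0 • w₀) ∈ B₂ := by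
  rw [forall_mulVec_mem_scaleLattice_iff_plane hϖ (endoGL_sub_one_col γ₂ u) (endoGL_sub_one_row γ₂ u) hc hb hpr hB hx₀ hx₀1 hprx,
    endoGL_sub_one_apply_one_one, compress_endoGL_sub_one, sub_one_mulVec_sub_sub_one_smul]

/-- **HEADLINE 2 — THE SQUARE-LEVEL PROFILE OF `Γ` IN PLANE LETTERS.**  Same data; then
`(Γ − 1)²·M ⊆ c·M ⟺ |(u − 1)²| ≤ |c| ∧ (∀ y ∈ B₂, c⁻¹·(γ₂ − 1)²y ∈ B₂) ∧ c⁻¹·((γ₂ − 1)²w₀ − (u − 1)²·w₀) ∈ B₂`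
(`c = ϖ^m`: the predicate `LatticeInLevel ϖ m ((Γ − 1)²) M` of the regular ∕ square-level pieces).  In ★ (C1)'s line model: `(lam − 1)²∕c ∈ 𝒪_j` and
`(((lam − 1)² − (u − 1)²)∕c)·B₂^♯ ⊆ B₂`, a SECOND multiplier `(lam − u)(lam + u − 2)∕c` next to ★ T2c's `lam − u`.
[cite: Kottwitz1986BaseChangeUnits, §1 pp. 240–241] [cite: BruhatTits1972, §10] [cite: Jacobowitz1962, §4] [cite: Rogawski1990, §4.9–§4.10 pp. 55–60] -/
theorem forall_endoGL_sub_one_sq_mulVec_mem_scaleLattice_iff_plane {ϖ : K} (hϖ : Valued.v ϖ = WithZero.exp (-1 : ℤ)) {c : K} (hc : c ≠ 0)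
    {M : Submodule 𝒪[K] (Fin 3 → K)} {b : ℕ} (hb : ∀ a : K, (Pi.single 1 a : Fin 3 → K) ∈ M ↔ Valued.v a ≤ Valued.v ϖ ^ b)
    (hpr : ∀ x ∈ M, Valued.v (x 1) * Valued.v ϖ ^ b ≤ 1)
    {B₂ : Submodule 𝒪[K] (Fin 2 → K)} {w₀ : Fin 2 → K} {x₀ : Fin 3 → K}
    (hB : B₂.map ((Matrix.toLin' (!![1, 0; 0, 0; 0, 1] : Matrix (Fin 3) (Fin 2) K)).restrictScalars 𝒪[K]) =
      M ⊓ LinearMap.ker ((LinearMap.proj (1 : Fin 3) : (Fin 3 → K) →ₗ[K] K).restrictScalars 𝒪[K]))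
    (hx₀ : x₀ ∈ M) (hx₀1 : Valued.v (x₀ 1) * Valued.v ϖ ^ b = 1) (hprx : x₀ - Pi.single 1 (x₀ 1) = ![w₀ 0, 0, w₀ 1])
    (γ₂ : GL (Fin 2) K) (u : GL (Fin 1) K) :
    (∀ x ∈ M, ((((endoGL (γ₂, u) : GL (Fin 3) K) : Matrix (Fin 3) (Fin 3) K) - 1) * (((endoGL (γ₂, u) : GL (Fin 3) K) : Matrix (Fin 3) (Fin 3) K) - 1)) *ᵥ x ∈
        scaleLattice c M) ↔
      Valued.v (((u : Matrix (Fin 1) (Fin 1) K) 0 0 - 1) ^ 2) ≤ Valued.v c ∧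
      (∀ y ∈ B₂, c⁻¹ • ((((γ₂ : Matrix (Fin 2) (Fin 2) K) - 1) * ((γ₂ : Matrix (Fin 2) (Fin 2) K) - 1)) *ᵥ y) ∈ B₂) ∧
        c⁻¹ • ((((γ₂ : Matrix (Fin 2) (Fin 2) K) - 1) * ((γ₂ : Matrix (Fin 2) (Fin 2) K) - 1)) *ᵥ w₀ - ((u : Matrix (Fin 1) (Fin 1) K) 0 0 - 1) ^ 2 • w₀) ∈ B₂ := by
  obtain ⟨hcol2, h11⟩ := endoGL_sub_one_sq_col γ₂ u
  rw [forall_mulVec_mem_scaleLattice_iff_plane hϖ hcol2 (endoGL_sub_one_sq_row γ₂ u) hc hb hpr hB hx₀ hx₀1 hprx, h11, compress_endoGL_sub_one_sq]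

end Plane

end Literature.NumberTheory.Automorphic.UnitaryLatticeTree

end
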